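import Mathlib
import Literature.Probability.Percolation.Percolation
import Literature.Probability.Percolation.CornerPercolation
import Literature.Probability.Percolation.SelfRefinementMeasure
import Literature.Probability.LatticeModels.ProdBernoulliClusterLocality
import Literature.Probability.LatticeModels.IsoradialPercolation
import Literature.Probability.LatticeModels.TriangularLattice
import Literature.Probability.LatticeModels.TriangularLatticeProofs
import Literature.Probability.Percolation.FullPlaneCNL
import Literature.Probability.Percolation.FullPlaneCNLPresentation
import Summits.CriticalPhenomena.CardyFormulaZ2.Theorems.CardyMagicRigidityHexSegmentDefs
import Summits.CriticalPhenomena.CardyFormulaZ2.Theorems.CardyMagicRigidityLoopLimitZ2EqTCoinMeasurable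
import HarnessLib

/-!
# Stub `stub_siteEnd` (S2) of line `Sketch`, crux `LoopLimitZ2EqT` (stmt-CriticalPhenomena-4833):
# endpoint `t = 0` — law identity, arena identity, reduction to site percolation on `𝕋`

Helper file (`--supports stmt-CriticalPhenomena-4833`) for the loop-level endpoint dictionary
`SiteEndLoops` of the hex-segment model at `t = 0`
(`CardyMagicRigidityHexSegmentDefs.lean`, §1, S2):
`d_CN((prodBernoulli (prm 0), segLoops δ), (P_{1/2}, siteLoopConfig δ)) → 0`.
Writing `τ S := {x | (x, some none) ∈ S}` for the **fair-coin layer** of a coin set `S` (the set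
of cells whose fair coin is heads) and `A τ := {upEdge x k | x ∈ τ}` for the **all-or-nothing**
bond configuration of a cell set `τ` (all three edges of the up-triangle at `x` open iff `x ∈ τ`),
this file proves, sorry-free:

* `siteEnd_law` — **(1) law identity**: the law of `τ` under `prodBernoulli (prm 0)` is critical
  site percolation `triSitePercolation half` (`prodBernoulli_map_preimage` along the injection
  `x ↦ (x, some none)`, all fair coins having parameter `1/2`, `prodBernoulli_const`).
* `siteEnd_ae_forall_type_notMem`, `siteEnd_cfg_eq`, `siteEnd_ae_cfg` — **(2)**: under `prm 0`
  the type bits have parameter `0`, so almost surely no type bit is present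
  (`prodBernoulli_ae_notMem`, countably many cells) and then `cfg S = A (τ S)`; hence
  `segLoops δ S = siteLoopConfig (δ/2) (refine (A (τ S)))` almost surely (`siteEnd_segLoops_eq`).
* `siteEnd_mem_refine_upEdge_iff`, `siteEnd_refine_upEdge_eq` — **(3) the arena identity at
  the level of configurations**: the half-mesh refinement of `A τ` is the `2`-block blow-up of
  `τ` with all corners open,
  `refine (A τ) = {v | (∀ i, 2 ∣ v i) ∨ ⌊v/2⌋ ∈ τ}` (`⌊v/2⌋ = fun i ↦ v i / 2`, Euclidean
  quotient): the doubled original vertices `2x` are open and the three midpoints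
  `2x + (1,0), 2x + (0,1), 2x + (1,1)` of the edges of the up-triangle at `x` are open iff
  `x ∈ τ` (`siteEnd_upEdge_sum`: the endpoints of `upEdge x k` sum to `2x +` one of these). In
  particular the open fine clusters are the blow-ups of the open site clusters of `τ` on `𝕋`
  with pendant or isolated corners attached, and the closed fine clusters are the blow-ups of the
  closed site clusters of `τ` minus their corners.
* `siteEnd_cnLawEDist_le`, `siteEnd_of_tendsto` — **reduction of S2 to a statement inside site
  percolation on `𝕋`**: at every mesh
  `d_CN((prodBernoulli (prm 0), segLoops δ), (P_{1/2}, siteLoopConfig δ)) ≤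
   d_CN((P_{1/2}, siteLoopConfig δ), (P_{1/2}, τ ↦ siteLoopConfig (δ/2) (refine (A τ))))`
  (a.s. equality of presentations `cnLawEDist_le_of_eqOn_snd`, pull-back of couplings along the
  factor map `τ`, `cnLawEDist_comp_snd_le`, and (1)), so that `SiteEndLoops` follows from the
  convergence to `0` of the right-hand side — the comparison, under ONE site configuration
  `τ ∼ P_{1/2}`, of its honeycomb loops at mesh `δ` with the honeycomb loops at mesh `δ/2` of
  its blow-up (pathwise loop dictionary `+` density of microscopic loops; file
  `CardyMagicRigidityLoopLimitZ2EqTSiteEndAssembly.lean`).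
-/

noncomputable section

open MeasureTheory Set Filter
open scoped Topology ENNReal

namespace Summit.CriticalPhenomena.CardyFormulaZ2.Cruxes.LoopLimitZ2EqT.HexSegment

open Literature.Probability.Percolation Literature.Probability.LatticeModels
  Literature.Probability.RandomPlanarGeometry

/-! ### The fair-coin layer and its law -/

/-- The embedding `x ↦ (x, some none)` of the fair-coin labels into the coins is injective. -/
theorem siteEnd_fairCoin_injective :
    Function.Injective fun x : Site 2 => ((x, some (none : Option (Fin 3))) : Coin) :=
  fun _ _ h => (Prod.mk.inj h).1

/-- **(1) Law of the fair-coin layer.** Under the coin measure `prodBernoulli (prm 0)` the set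
`τ S = {x | (x, some none) ∈ S}` of cells whose fair coin is heads is distributed as critical
site percolation `triSitePercolation half = P_{1/2}` on `𝕋` (pull-back of a product Bernoulli
measure along an injection, `prodBernoulli_map_preimage`; all fair coins have parameter `1/2`). -/
theorem siteEnd_law :
    (prodBernoulli (prm 0)).map
        (fun S : Set Coin => ({x : Site 2 | ((x, some (none : Option (Fin 3))) : Coin) ∈ S} :
          SiteConfig (Site 2))) = triSitePercolation half := by
  have h := prodBernoulli_map_preimage (prm 0) siteEnd_fairCoin_injective
  change (prodBernoulli (prm 0)).map (fun S : Set Coin =>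
    (fun x : Site 2 => ((x, some (none : Option (Fin 3))) : Coin)) ⁻¹' S) = _
  rw [h]
  exact prodBernoulli_const half

/-! ### Almost surely every cell is of site type -/

/-- Under `prm 0` every type bit `(x, none)` has parameter `0`, so almost surely NO type bit is
present (countably many coordinate events of full measure). -/
theorem siteEnd_ae_forall_type_notMem :
    ∀ᵐ S ∂prodBernoulli (prm 0), ∀ x : Site 2, ((x, (none : Option (Option (Fin 3)))) : Coin) ∉ S := by
  have h : ∀ x : Site 2, ∀ᵐ S ∂prodBernoulli (prm 0),
      ((x, (none : Option (Option (Fin 3)))) : Coin) ∉ S :=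
    fun x => prodBernoulli_ae_notMem _ rfl
  exact ae_all_iff.2 h

/-- With no type bit present every cell is of site type: `cfg S` is the **all-or-nothing**
bond configuration of the fair-coin layer `τ S` — all three edges of the up-triangle at `x` are
open iff `x ∈ τ S`. -/
theorem siteEnd_cfg_eq {S : Set Coin}
    (hS : ∀ x : Site 2, ((x, (none : Option (Option (Fin 3)))) : Coin) ∉ S) :
    cfg S = {e | ∃ (x : Site 2) (k : Fin 3), e = upEdge x k ∧
      x ∈ ({x : Site 2 | ((x, some (none : Option (Fin 3))) : Coin) ∈ S} : SiteConfig (Site 2))} := by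
  ext e
  simp only [cfg, mem_setOf_eq]
  constructor
  · rintro ⟨x, k, rfl, h⟩
    rcases h with ⟨h, -⟩ | ⟨-, h⟩
    · exact absurd h (hS x)
    · exact ⟨x, k, rfl, h⟩
  · rintro ⟨x, k, rfl, h⟩
    exact ⟨x, k, rfl, Or.inr ⟨hS x, h⟩⟩

/-- **(2)** Almost surely under `prm 0`, `cfg S` is the all-or-nothing configuration of the
fair-coin layer. -/
theorem siteEnd_ae_cfg :
    ∀ᵐ S ∂prodBernoulli (prm 0), cfg S = {e | ∃ (x : Site 2) (k : Fin 3), e = upEdge x k ∧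
      x ∈ ({x : Site 2 | ((x, some (none : Option (Fin 3))) : Coin) ∈ S} : SiteConfig (Site 2))} := by
  filter_upwards [siteEnd_ae_forall_type_notMem] with S hS
  exact siteEnd_cfg_eq hS

/-! ### The arena identity (configuration level) -/

/-- The sum of the two endpoints of the edge `upEdge a k` is `2a + (1,0)`, `2a + (0,1)` or
`2a + (1,1)`: halved coordinatewise (Euclidean division) it is `a`, and it has an odd coordinate. -/
theorem siteEnd_upEdge_sum {x y a : Site 2} {k : Fin 3} (h : s(x, y) = upEdge a k) :
    (fun i => (x + y) i / 2) = a ∧ ¬ ∀ i, (2 : ℤ) ∣ (x + y) i := by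
  have key : ∀ {p q : Site 2}, s(x, y) = s(p, q) → x + y = p + q := by
    intro p q hpq
    rcases Sym2.eq_iff.1 hpq with ⟨rfl, rfl⟩ | ⟨rfl, rfl⟩
    · rfl
    · exact add_comm _ _
  have h0 : ∀ {p q : Site 2}, s(x, y) = s(p, q) → x 0 + y 0 = p 0 + q 0 := fun hpq => by
    have := congrFun (key hpq) 0
    simpa only [Pi.add_apply] using this
  have h1 : ∀ {p q : Site 2}, s(x, y) = s(p, q) → x 1 + y 1 = p 1 + q 1 := fun hpq => by
    have := congrFun (key hpq) 1
    simpa only [Pi.add_apply] using this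
  suffices H : x 0 + y 0 = a 0 + a 0 + (if k = 1 then 0 else 1) ∧
      x 1 + y 1 = a 1 + a 1 + (if k = 0 then 0 else 1) by
    obtain ⟨H0, H1⟩ := H
    refine ⟨?_, fun hd => ?_⟩
    · ext i
      fin_cases i
      · show (x 0 + y 0) / 2 = a 0
        split_ifs at H0 <;> omega
      · show (x 1 + y 1) / 2 = a 1
        split_ifs at H1 <;> omega
    · obtain ⟨c, hc⟩ := hd 0
      obtain ⟨d, hd'⟩ := hd 1
      rw [Pi.add_apply] at hc hd'
      split_ifs at H0 H1 with hk hk' <;> omega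
  fin_cases k
  · simp only [upEdge, Fin.zero_eta, Fin.isValue, ↓reduceIte] at h
    have e0 := h0 h
    have e1 := h1 h
    simp only [Pi.add_apply, Matrix.cons_val_zero, Matrix.cons_val_one] at e0 e1
    simp only [Fin.zero_eta, Fin.isValue, zero_ne_one, ↓reduceIte]
    constructor <;> omega
  · simp only [upEdge, Fin.mk_one, Fin.isValue, one_ne_zero, ↓reduceIte] at h
    have e0 := h0 h
    have e1 := h1 h
    simp only [Pi.add_apply, Matrix.cons_val_zero, Matrix.cons_val_one] at e0 e1
    simp only [Fin.mk_one, Fin.isValue, ↓reduceIte, one_ne_zero]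
    constructor <;> omega
  · simp only [upEdge, Fin.reduceFinMk, Fin.isValue, Fin.reduceEq, ↓reduceIte] at h
    have e0 := h0 h
    have e1 := h1 h
    simp only [Pi.add_apply, Matrix.cons_val_zero, Matrix.cons_val_one] at e0 e1
    simp only [Fin.reduceFinMk, Fin.isValue, Fin.reduceEq, ↓reduceIte]
    constructor <;> omega

/-- `a ∼ a + e₀ - e₁`-type adjacency: the third edge of the up-triangle at `a`. -/
theorem siteEnd_adj_add_vec10_add_vec01 (a : Site 2) :
    triGraph.Adj (a + (![1, 0] : Site 2)) (a + (![0, 1] : Site 2)) := by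
  rw [triGraph_adj_iff_eq_add]
  refine Or.inr (Or.inr (Or.inr (Or.inr (Or.inr ?_))))
  rw [add_assoc]
  congr 1
  decide

/-- **(3) Arena identity, configuration level.** The half-mesh refinement of the all-or-nothing
bond configuration of a cell set `τ` is the `2`-block blow-up of `τ` with all corners open: the
fine site `v` of `ℤ²` is open iff both coordinates of `v` are even (a doubled original vertex)
or the cell `⌊v/2⌋` (coordinatewise Euclidean quotient) belongs to `τ` (a midpoint of an edge of
the open up-triangle `⌊v/2⌋`). -/
theorem siteEnd_mem_refine_upEdge_iff (τ : SiteConfig (Site 2)) (v : Site 2) :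
    v ∈ refine {e | ∃ (x : Site 2) (k : Fin 3), e = upEdge x k ∧ x ∈ τ} ↔
      (∀ i, (2 : ℤ) ∣ v i) ∨ (fun i => v i / 2) ∈ τ := by
  constructor
  · rintro ⟨x, y, rfl, rfl | ⟨-, a, k, hak, ha⟩⟩
    · exact Or.inl fun i => ⟨x i, by rw [Pi.add_apply, two_mul]⟩
    · right
      rw [(siteEnd_upEdge_sum hak).1]
      exact ha
  · rintro (h | h)
    · refine ⟨fun i => v i / 2, fun i => v i / 2, ?_, Or.inl rfl⟩
      ext i
      simp only [Pi.add_apply]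
      obtain ⟨c, hc⟩ := h i
      omega
    · set a : Site 2 := fun i => v i / 2 with ha
      have ha0 : a 0 = v 0 / 2 := rfl
      have ha1 : a 1 = v 1 / 2 := rfl
      rcases Int.emod_two_eq_zero_or_one (v 0) with h0 | h0 <;>
        rcases Int.emod_two_eq_zero_or_one (v 1) with h1 | h1
      · refine ⟨a, a, ?_, Or.inl rfl⟩
        ext i
        fin_cases i
        · show v 0 = a 0 + a 0
          omega
        · show v 1 = a 1 + a 1
          omega
      · refine ⟨a, a + (![0, 1] : Site 2), ?_, Or.inr ⟨?_, a, 1, ?_, h⟩⟩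
        · ext i
          fin_cases i
          · show v 0 = a 0 + (a 0 + 0)
            omega
          · show v 1 = a 1 + (a 1 + 1)
            omega
        · rw [vec01_eq_single]
          exact triGraph_adj_self_add_single a 1
        · simp [upEdge]
      · refine ⟨a, a + (![1, 0] : Site 2), ?_, Or.inr ⟨?_, a, 0, ?_, h⟩⟩
        · ext i
          fin_cases i
          · show v 0 = a 0 + (a 0 + 1)
            omega
          · show v 1 = a 1 + (a 1 + 0)
            omega
        · rw [vec10_eq_single]
          exact triGraph_adj_self_add_single a 0
        · simp [upEdge]
      · refine ⟨a + (![1, 0] : Site 2), a + (![0, 1] : Site 2), ?_,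
          Or.inr ⟨siteEnd_adj_add_vec10_add_vec01 a, a, 2, ?_, h⟩⟩
        · ext i
          fin_cases i
          · show v 0 = a 0 + 1 + (a 0 + 0)
            omega
          · show v 1 = a 1 + 0 + (a 1 + 1)
            omega
        · simp [upEdge]

/-- (3) as an equality of site configurations. -/
theorem siteEnd_refine_upEdge_eq : ∀ τ : SiteConfig (Site 2),
    refine {e | ∃ (x : Site 2) (k : Fin 3), e = upEdge x k ∧ x ∈ τ} =
      {v : Site 2 | (∀ i, (2 : ℤ) ∣ v i) ∨ (fun i => v i / 2) ∈ τ} :=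
  fun τ => Set.ext (siteEnd_mem_refine_upEdge_iff τ)

/-! ### Reduction of S2 to a statement inside site percolation on `𝕋` -/

/-- The fair-coin layer map `S ↦ τ S` is measurable. -/
theorem siteEnd_measurable_fairLayer :
    Measurable fun S : Set Coin =>
      ({x : Site 2 | ((x, some (none : Option (Fin 3))) : Coin) ∈ S} : SiteConfig (Site 2)) :=
  measurable_set_iff.2 fun _ => measurable_set_mem _

/-- The all-or-nothing bond configuration `τ ↦ {upEdge x k | x ∈ τ}` is a measurable function of
the cell set. -/
theorem siteEnd_measurable_allOrNothing :
    Measurable fun τ : SiteConfig (Site 2) =>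
      ({e | ∃ (x : Site 2) (k : Fin 3), e = upEdge x k ∧ x ∈ τ} : BondConfig (Site 2)) := by
  refine measurable_set_iff.2 fun _ => ?_
  exact Measurable.exists fun _ => Measurable.exists fun _ =>
    measurable_const.and (measurable_set_mem _)

/-- The event "no type bit is present" is measurable. -/
theorem siteEnd_measurableSet_noType :
    MeasurableSet {S : Set Coin | ∀ x : Site 2, ((x, (none : Option (Option (Fin 3)))) : Coin) ∉ S} :=
  (Measurable.forall fun _ => (measurable_set_mem _).not).setOf

/-- On the event "no type bit", the segment loops at mesh `δ` are the typed honeycomb loops at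
mesh `δ/2` of the blown-up fair-coin layer (a function of `τ S` alone). -/
theorem siteEnd_segLoops_eq {S : Set Coin}
    (hS : ∀ x : Site 2, ((x, (none : Option (Option (Fin 3)))) : Coin) ∉ S) (δ : ℝ) :
    segLoops δ S = siteLoopConfig (δ / 2) (refine {e | ∃ (x : Site 2) (k : Fin 3), e = upEdge x k ∧
      x ∈ ({x : Site 2 | ((x, some (none : Option (Fin 3))) : Coin) ∈ S} : SiteConfig (Site 2))}) := by
  rw [segLoops, triBondLoops, siteEnd_cfg_eq hS]

/-- **Reduction (change of presentation).** At every mesh, `d_CN` between the segment loops under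
`prm 0` and site-`𝕋` is at most `d_CN` between site-`𝕋` and the SAME site configuration read
through the blow-up `τ ↦ siteLoopConfig (δ/2) (refine {upEdge x k | x ∈ τ})`, both under
`P_{1/2}`: the segment loops are a.s. a function of the fair-coin layer
(`cnLawEDist_le_of_eqOn_snd`), a coupling with the law `P_{1/2}` of that layer pulls back to
the coin space (`cnLawEDist_comp_snd_le`, standard Borel lattice space), and the layer has law
`P_{1/2}` (`siteEnd_law`). -/
theorem siteEnd_cnLawEDist_le (δ : ℝ) :
    LoopConfig.cnLawEDist (prodBernoulli (prm 0)) (segLoops δ) (triSitePercolation half)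
        (siteLoopConfig δ) ≤
      LoopConfig.cnLawEDist (triSitePercolation half) (siteLoopConfig δ) (triSitePercolation half)
        (fun τ : SiteConfig (Site 2) => siteLoopConfig (δ / 2)
          (refine {e | ∃ (x : Site 2) (k : Fin 3), e = upEdge x k ∧ x ∈ τ})) := by
  haveI := standardBorelSpace_siteConfig
  have h0 : prodBernoulli (prm 0)
      {S : Set Coin | ∀ x : Site 2, ((x, (none : Option (Option (Fin 3)))) : Coin) ∉ S}ᶜ = 0 := by
    rw [Set.compl_setOf]
    exact ae_iff.1 siteEnd_ae_forall_type_notMem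
  have heq : EqOn
      ((fun τ : SiteConfig (Site 2) => siteLoopConfig (δ / 2)
          (refine {e | ∃ (x : Site 2) (k : Fin 3), e = upEdge x k ∧ x ∈ τ})) ∘
        fun S : Set Coin =>
          ({x : Site 2 | ((x, some (none : Option (Fin 3))) : Coin) ∈ S} : SiteConfig (Site 2)))
      (segLoops δ)
      {S : Set Coin | ∀ x : Site 2, ((x, (none : Option (Option (Fin 3)))) : Coin) ∉ S} :=
    fun S hS => (siteEnd_segLoops_eq hS δ).symm
  rw [LoopConfig.cnLawEDist_comm]
  calc LoopConfig.cnLawEDist (triSitePercolation half) (siteLoopConfig δ) (prodBernoulli (prm 0))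
        (segLoops δ)
      ≤ LoopConfig.cnLawEDist (triSitePercolation half) (siteLoopConfig δ) (prodBernoulli (prm 0))
          (((fun τ : SiteConfig (Site 2) => siteLoopConfig (δ / 2)
            (refine {e | ∃ (x : Site 2) (k : Fin 3), e = upEdge x k ∧ x ∈ τ})) ∘
          fun S : Set Coin =>
            ({x : Site 2 | ((x, some (none : Option (Fin 3))) : Coin) ∈ S} : SiteConfig (Site 2)))) :=
        cnLawEDist_le_of_eqOn_snd siteEnd_measurableSet_noType h0 heq
    _ ≤ LoopConfig.cnLawEDist (triSitePercolation half) (siteLoopConfig δ)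
          ((prodBernoulli (prm 0)).map fun S : Set Coin =>
            ({x : Site 2 | ((x, some (none : Option (Fin 3))) : Coin) ∈ S} : SiteConfig (Site 2)))
          (fun τ : SiteConfig (Site 2) => siteLoopConfig (δ / 2)
            (refine {e | ∃ (x : Site 2) (k : Fin 3), e = upEdge x k ∧ x ∈ τ})) :=
        cnLawEDist_comp_snd_le _ _ _ siteEnd_measurable_fairLayer _
    _ = _ := by rw [siteEnd_law]

/-- **S2 reduced to site percolation.** `SiteEndLoops` follows from the convergence to `0`, as
`δ → 0⁺`, of `d_CN` between the typed honeycomb loops of critical site percolation `τ` on `δ𝕋`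
and the typed honeycomb loops at mesh `δ/2` of its blow-up `refine {upEdge x k | x ∈ τ}` (both
under `P_{1/2}`; `siteEnd_cnLawEDist_le` and a sandwich). -/
theorem siteEnd_of_tendsto :
    Tendsto (fun δ : ℝ => LoopConfig.cnLawEDist (triSitePercolation half) (siteLoopConfig δ)
      (triSitePercolation half) (fun τ : SiteConfig (Site 2) => siteLoopConfig (δ / 2)
        (refine {e | ∃ (x : Site 2) (k : Fin 3), e = upEdge x k ∧ x ∈ τ}))) (𝓝[>] 0) (𝓝 0) →
    SiteEndLoops :=
  fun h => tendsto_of_tendsto_of_tendsto_of_le_of_le tendsto_const_nhds h (fun _ => bot_le)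
    fun δ => siteEnd_cnLawEDist_le δ

end Summit.CriticalPhenomena.CardyFormulaZ2.Cruxes.LoopLimitZ2EqT.HexSegment

end
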